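import Summits.Ventures.CertifiedArithmetic.LowPrec.SRThresholdsIff
import HarnessLib

/-!
# The threshold table as `iff` rows: thirteen value sets, three rules, every bit count

HONEST FRAMING: certified error envelopes and provably optimal rounding/accumulation schemes for
low-precision formats under stated cost models; every table by two implementations; no hardware or
vendor claims.

File XCI of the SR slice.  `ThresholdsIff φ L P I₁ I₂` packages file XC row-wise: for EVERY bit
count `N` and EACH of the three P3109 rules separately — every summation tree of format data is
exact in law iff `L ≤ N`; every exact product of two values has an `N`-dyadic up-probability iff
`P ≤ N`; every one-stage inner product is exact in law iff `I₁ ≤ N`; every two-stage inner product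
is exact in law iff `I₂ ≤ N` (`TreeExact`, `ProdDyadic`, `IP1Exact`, `IP2Exact`).
`thresholdsIff_of_format` derives a row from the format parameters (XC's four `iff` theorems); the
instances are the rows of the published table (`THEOREMS-R3 §7s`, `paper/sr.tex` summary table),
now each an equivalence: `binary8p3/8p4/8p5(F)`, `FnuzE5M2/E4M3`, `E4M3`, `E5M2`, `E3M2`, `E2M3`,
`binary16`, `bfloat16`, `binary32` — e.g. `ThresholdsIff E4M3 14 9 23 14`,
`ThresholdsIff binary8p5 6 7 13 7`, `ThresholdsIff binary32 253 149 402 253`.  (The `J` column of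
`Thresholds` — `quantum²` needs exactly `J` bits — is a single state and has no `iff` of its own;
it enters through `P = max (m+1) J` and `I₁ = L + J`.)
-/

namespace Summit.Ventures.CertifiedArithmetic.LowPrec.SR.LimitedBits

open Literature.ComputerArithmetic.P3109
open Literature.ComputerArithmetic.ConnollyHighamMary2021
open Literature.ComputerArithmetic.FloatingPoint (Format MiniFloat)
open Literature.ComputerArithmetic.FloatingPoint.MiniFloat (valueSet valueSet_nonempty)
open Summit.Ventures.CertifiedArithmetic.LowPrec.SR
open Finset STree

/-! ### Row predicates -/

/-- Every summation tree with leaves in `valueSet φ` has the exact-SR law under the rule `q`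
(all expectations agree). -/
def TreeExact (φ : Format) (q : ℚ → ℚ) : Prop :=
  ∀ T : STree ℚ, LeavesIn (valueSet φ) T → ∀ f : ℚ → ℚ,
    treeExpQ (valueSet φ) q T f = treeExp (valueSet φ) T f

/-- Every one-stage inner product of format vectors (exact products accumulated from a format
start) has the exact-SR law under the rule `q`. -/
def IP1Exact (φ : Format) (q : ℚ → ℚ) : Prop :=
  ∀ {x y : ℕ → ℚ}, (∀ k, x k ∈ valueSet φ) → (∀ k, y k ∈ valueSet φ) →
    ∀ {s : ℚ}, s ∈ valueSet φ → ∀ (n : ℕ) (f : ℚ → ℚ),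
    accExpQ (valueSet φ) q (fun k => x k * y k) n f s
      = accExp (valueSet φ) (fun k => x k * y k) n f s

/-- Every two-stage inner product of format vectors (products SR-rounded into the format, then
accumulated from a format start) has the exact-SR law under the rule `q`. -/
def IP2Exact (φ : Format) (q : ℚ → ℚ) : Prop :=
  ∀ {x y : ℕ → ℚ}, (∀ k, x k ∈ valueSet φ) → (∀ k, y k ∈ valueSet φ) →
    ∀ {s : ℚ}, s ∈ valueSet φ → ∀ (n : ℕ) (f : ℚ → ℚ),
    ipExpQ (valueSet φ) q (fun k => x k * y k) n f s
      = ipExp (valueSet φ) (fun k => x k * y k) n f s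

/-- Every exact product of two values has an `N`-bit dyadic up-probability. -/
def ProdDyadic (φ : Format) (N : ℕ) : Prop :=
  ∀ a ∈ valueSet φ, ∀ b ∈ valueSet φ, Dyadic N (pUp (valueSet φ) (a * b))

/-- **A threshold row as equivalences.** `ThresholdsIff φ L P I₁ I₂`: for every `N` and each of the
rules `A`, `B`, `C` — trees exact in law iff `L ≤ N`; products `N`-dyadic iff `P ≤ N`; one-stage
inner products exact iff `I₁ ≤ N`; two-stage inner products exact iff `I₂ ≤ N`. -/
def ThresholdsIff (φ : Format) (L P I₁ I₂ : ℕ) : Prop := ∀ N : ℕ,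
  ((TreeExact φ (probAwayA N) ↔ L ≤ N) ∧ (TreeExact φ (probAwayB N) ↔ L ≤ N) ∧
    (TreeExact φ (probAwayC N) ↔ L ≤ N)) ∧
  (ProdDyadic φ N ↔ P ≤ N) ∧
  ((IP1Exact φ (probAwayA N) ↔ I₁ ≤ N) ∧ (IP1Exact φ (probAwayB N) ↔ I₁ ≤ N) ∧
    (IP1Exact φ (probAwayC N) ↔ I₁ ≤ N)) ∧
  ((IP2Exact φ (probAwayA N) ↔ I₂ ≤ N) ∧ (IP2Exact φ (probAwayB N) ↔ I₂ ≤ N) ∧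
    (IP2Exact φ (probAwayC N) ↔ I₂ ≤ N))

/-- **Every format has its row as equivalences** (`emaxCode ≥ 2`, `topMan ≥ 1`, `bias + m ≥ 3`,
`m ≥ 1`, `emaxCode + bias ≥ 4`, `bias ≤ emaxCode`): `L = emaxCode − 1`, `P = max (m+1) (bias+m−1)`,
`I₁ = L + (bias+m−1)`, `I₂ = max L P` — numerals passed with their defining equations. -/
theorem thresholdsIff_of_format (φ : Format) (L P I₁ I₂ : ℕ) (hL : φ.emaxCode - 1 = L)
    (hP : max (φ.manBits + 1) (φ.bias + φ.manBits - 1) = P)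
    (hI₁ : φ.emaxCode - 1 + (φ.bias + φ.manBits - 1) = I₁) (hI₂ : max L P = I₂)
    (hE : 2 ≤ φ.emaxCode) (ht : 1 ≤ φ.topMan) (h3 : 3 ≤ φ.bias + φ.manBits) (hm : 1 ≤ φ.manBits)
    (hn : 4 ≤ φ.emaxCode + φ.bias) (hb : φ.bias ≤ φ.emaxCode) : ThresholdsIff φ L P I₁ I₂ := by
  intro N
  have hT := tree_threshold_iff φ hE ht h3 N
  have hI := ip1_threshold_iff φ hE ht h3 N
  have hPr := prod_threshold_iff φ hE ht h3 hm hn N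
  have hI2 := ip2_threshold_iff φ hE ht h3 hm hn hb N
  subst hL hP hI₁ hI₂
  exact ⟨hT, hPr, hI, hI2⟩

/-! ### The rows -/

/-- **P3109 `binary8p3` (Extended): trees `30`, products `17`, IP1 `47`, IP2 `30` — iff.** -/
theorem binary8p3_thresholdsIff : ThresholdsIff Format.Binary8p3 30 17 47 30 :=
  thresholdsIff_of_format _ _ _ _ _ (by decide) (by decide) (by decide) (by decide) (by decide)
    (by decide) (by decide) (by decide) (by decide) (by decide)

/-- **P3109 `binary8p4` (Extended): `14`, `10`, `24`, `14` — iff.** -/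
theorem binary8p4_thresholdsIff : ThresholdsIff Format.Binary8p4 14 10 24 14 :=
  thresholdsIff_of_format _ _ _ _ _ (by decide) (by decide) (by decide) (by decide) (by decide)
    (by decide) (by decide) (by decide) (by decide) (by decide)

/-- **P3109 `binary8p5` (Extended): `6`, `7`, `13`, `7` — iff** (the one tabulated 8-bit format
whose two-stage threshold is the product rounding, `7 > 6`). -/
theorem binary8p5_thresholdsIff : ThresholdsIff Format.Binary8p5 6 7 13 7 :=
  thresholdsIff_of_format _ _ _ _ _ (by decide) (by decide) (by decide) (by decide) (by decide)
    (by decide) (by decide) (by decide) (by decide) (by decide)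

/-- **P3109 `binary8p3` (Finite): `30`, `17`, `47`, `30` — iff.** -/
theorem binary8p3F_thresholdsIff : ThresholdsIff Format.Binary8p3F 30 17 47 30 :=
  thresholdsIff_of_format _ _ _ _ _ (by decide) (by decide) (by decide) (by decide) (by decide)
    (by decide) (by decide) (by decide) (by decide) (by decide)

/-- **P3109 `binary8p4` (Finite): `14`, `10`, `24`, `14` — iff.** -/
theorem binary8p4F_thresholdsIff : ThresholdsIff Format.Binary8p4F 14 10 24 14 :=
  thresholdsIff_of_format _ _ _ _ _ (by decide) (by decide) (by decide) (by decide) (by decide)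
    (by decide) (by decide) (by decide) (by decide) (by decide)

/-- **FNUZ pair: `FnuzE5M2` `30, 17, 47, 30`; `FnuzE4M3` `14, 10, 24, 14` — iff.** -/
theorem fnuz_thresholdsIff :
    ThresholdsIff Format.FnuzE5M2 30 17 47 30 ∧ ThresholdsIff Format.FnuzE4M3 14 10 24 14 :=
  ⟨thresholdsIff_of_format _ _ _ _ _ (by decide) (by decide) (by decide) (by decide) (by decide)
      (by decide) (by decide) (by decide) (by decide) (by decide),
    thresholdsIff_of_format _ _ _ _ _ (by decide) (by decide) (by decide) (by decide) (by decide)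
      (by decide) (by decide) (by decide) (by decide) (by decide)⟩

/-- **OCP FP8: `E4M3` `14, 9, 23, 14`; `E5M2` `29, 16, 45, 29` — iff.** -/
theorem ocp_fp8_thresholdsIff :
    ThresholdsIff Format.E4M3 14 9 23 14 ∧ ThresholdsIff Format.E5M2 29 16 45 29 :=
  ⟨thresholdsIff_of_format _ _ _ _ _ (by decide) (by decide) (by decide) (by decide) (by decide)
      (by decide) (by decide) (by decide) (by decide) (by decide),
    thresholdsIff_of_format _ _ _ _ _ (by decide) (by decide) (by decide) (by decide) (by decide)
      (by decide) (by decide) (by decide) (by decide) (by decide)⟩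

/-- **OCP FP6: `E3M2` `6, 4, 10, 6`; `E2M3` `2, 4, 5, 4` — iff** (`E2M3`: bias `1`, the normal term
`m + 1 = 4` of the product law binds, `P = 4 > J = 3`). -/
theorem ocp_fp6_thresholdsIff :
    ThresholdsIff Format.E3M2 6 4 10 6 ∧ ThresholdsIff Format.E2M3 2 4 5 4 :=
  ⟨thresholdsIff_of_format _ _ _ _ _ (by decide) (by decide) (by decide) (by decide) (by decide)
      (by decide) (by decide) (by decide) (by decide) (by decide),
    thresholdsIff_of_format _ _ _ _ _ (by decide) (by decide) (by decide) (by decide) (by decide)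
      (by decide) (by decide) (by decide) (by decide) (by decide)⟩

set_option maxRecDepth 8192 in
/-- **IEEE `binary16`: `29, 24, 53, 29` — iff.** -/
theorem binary16_thresholdsIff : ThresholdsIff Format.Binary16 29 24 53 29 :=
  thresholdsIff_of_format _ _ _ _ _ (by decide) (by decide) (by decide) (by decide) (by decide)
    (by decide) (by decide) (by decide) (by decide) (by decide)

set_option maxRecDepth 8192 in
/-- **`bfloat16`: `253, 133, 386, 253` — iff.** -/
theorem bfloat16_thresholdsIff : ThresholdsIff Format.BFloat16 253 133 386 253 :=
  thresholdsIff_of_format _ _ _ _ _ (by decide) (by decide) (by decide) (by decide) (by decide)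
    (by decide) (by decide) (by decide) (by decide) (by decide)

set_option maxRecDepth 8192 in
/-- **IEEE `binary32`: `253, 149, 402, 253` — iff.** -/
theorem binary32_thresholdsIff : ThresholdsIff Format.Binary32 253 149 402 253 :=
  thresholdsIff_of_format _ _ _ _ _ (by decide) (by decide) (by decide) (by decide) (by decide)
    (by decide) (by decide) (by decide) (by decide) (by decide)

/-- **Reading a row** (the numbers are thresholds in the strongest sense): below `L` some tree,
below `P` some product, below `I₁` some one-stage and below `I₂` some two-stage inner product of
format data is biased under EACH rule; from the threshold on, everything is exact in law. -/
theorem ThresholdsIff.below_and_above {φ : Format} {L P I₁ I₂ : ℕ}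
    (h : ThresholdsIff φ L P I₁ I₂) :
    (∀ N, N < L → ¬ TreeExact φ (probAwayA N) ∧ ¬ TreeExact φ (probAwayB N) ∧
        ¬ TreeExact φ (probAwayC N)) ∧
    (∀ N, L ≤ N → TreeExact φ (probAwayA N) ∧ TreeExact φ (probAwayB N) ∧
        TreeExact φ (probAwayC N)) ∧
    (∀ N, (ProdDyadic φ N ↔ P ≤ N)) ∧
    (∀ N, N < I₁ → ¬ IP1Exact φ (probAwayA N) ∧ ¬ IP1Exact φ (probAwayB N) ∧
        ¬ IP1Exact φ (probAwayC N)) ∧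
    (∀ N, N < I₂ → ¬ IP2Exact φ (probAwayA N) ∧ ¬ IP2Exact φ (probAwayB N) ∧
        ¬ IP2Exact φ (probAwayC N)) ∧
    (∀ N, I₂ ≤ N → IP2Exact φ (probAwayA N) ∧ IP2Exact φ (probAwayB N) ∧
        IP2Exact φ (probAwayC N)) := by
  refine ⟨fun N hN => ?_, fun N hN => ?_, fun N => (h N).2.1, fun N hN => ?_, fun N hN => ?_,
    fun N hN => ?_⟩
  · obtain ⟨⟨hA, hB, hC⟩, -⟩ := h N
    exact ⟨fun h' => by have := hA.mp h'; omega, fun h' => by have := hB.mp h'; omega,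
      fun h' => by have := hC.mp h'; omega⟩
  · obtain ⟨⟨hA, hB, hC⟩, -⟩ := h N
    exact ⟨hA.mpr hN, hB.mpr hN, hC.mpr hN⟩
  · obtain ⟨-, -, ⟨hA, hB, hC⟩, -⟩ := h N
    exact ⟨fun h' => by have := hA.mp h'; omega, fun h' => by have := hB.mp h'; omega,
      fun h' => by have := hC.mp h'; omega⟩
  · obtain ⟨-, -, -, hA, hB, hC⟩ := h N
    exact ⟨fun h' => by have := hA.mp h'; omega, fun h' => by have := hB.mp h'; omega,
      fun h' => by have := hC.mp h'; omega⟩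
  · obtain ⟨-, -, -, hA, hB, hC⟩ := h N
    exact ⟨hA.mpr hN, hB.mpr hN, hC.mpr hN⟩

end Summit.Ventures.CertifiedArithmetic.LowPrec.SR.LimitedBits
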